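import Summits.QuantumFields.BalabanUV.Beta.SecondOrderContactMmReadDefect
import Summits.QuantumFields.BalabanUV.Beta.E3ContactFactor

/-!
# `BalabanUV.Beta.SecondOrderStepEvalSym` — binder row D1, (N7a″) of the second-order hR slot port: **THE REFLECTION LAW OF THE NEXT LEVEL'S FIELD–FIELD
# SECOND-ORDER TABLE, EVALUATED CHART-FREE, FOR THE (0.4) LITERAL'S SYMMETRISED RESOLVENTS `Gsym j` AGAINST THE SHIFTED SPREAD `bhKStepSh d Lc Dsh j`**
# — the twin of `SecondOrderStepEval.mmRead_K3OfK_stepProp_bref` (comb, chart (I): `axEc` commutes with every diagonal) with the engine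
# `SecondOrderInverseShape.K3_sharp_rel` REPLACED by `SecondOrderInverseShapeDefect.K3_sharp_defect` + gen-28's block facts (NO slice projector, NO
# commutation) and the coarse-symbol evaluation `SecondOrderContactMmRead.mmSym_dressedGen_inl` (rule 4 for `axEc`) REPLACED by the chart-free border rule
# `E3ContactFactor.dressedGenM_zsmul_inr` (generator `ctGenM B`, any border `B`)
# (β sub-cell, BINDER-OWNERS row D1 OWNER `b2b-balaban-beta-an2`, gen 31; memo `gen30/N7-SCOPE.v1.md` §4 (N7a)→(N7b), RULING R-D1-g28-2 (F)+(S)+(M))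

HONEST FRAMING (cell charter, verbatim): «discharging BetaPertH makes Bałaban's UV stability UNCONDITIONAL — a real constructive-QFT result; it is
NOT the continuum limit and NOT the Clay problem.»  HONEST DEPENDENCY: continuum YM on T⁴ ⇐ BetaPertH ∧ nine spine estimates (0/9 proved); BetaPertH
⇐ (D1) ∧ (D4) ∧ CAP+tail; G-an2-4 gates asym, D1 and NE2/3/4.  DERIVED cell leaf: [folklore] kernel algebra over OUR objects; no statement of Bałaban's
papers, no `[cite:]`, no `def`, no `Prop` fact; instantiates no binder of the wall.  NOT D1, NOT `BetaPertH`, NOT continuum, NOT Clay.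

WHAT.
* §1 `dressedGenM_smul_eq` (the `γ`-scaled `ℋ`-dressed generator is `γ ·` the dressed generator), **`mmSym_dressedGenM_inl`**: for spread `K`, `B`, a
  spread `𝕄` with multiplier–field block `σ·B_mf`, multiplier block `0` and `(𝕄∘K)_mm = 1_coarse`, the COARSE SYMBOL of the `γ`-scaled dressed generator on
  the field legs is `(γ/(σ·Lc^{d+1})) · ctGenM d B α Lc μ y x′ (inl m)` (chart-free twin of `SecondOrderContactMmRead.mmSym_dressedGen_inl`).
* §2 **`mmRead_K3OfK_bref_of_lawM`** (level-generic, chart-free): for a spread reflection-fixed `K` with coarse multiplier legs, a spread `𝕄` with the four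
  block facts of `RelInvFactorSandwich.mm_sandwich_conjV_diagK` and the border blocks above; first-order tables `S`, `M` with the sharp laws at contact
  `γ · ctGenM d B α Lc` against `𝕄`, a second-order table `W` whose sharp law has a ♯-bi-table OF SIMILARITY SHAPE up to a remainder `R`; localisations:
  `mmRead Lc (K3OfK K Lc S M W μ (bref y) ν (bref y′)) = (ε_μ ε_ν) • refK (Φ Lc α) ( mmRead Lc (K3OfK K Lc S M W μ y ν y′)
     + conjW (mmRead Lc K) (mmRead Lc (K2OfK … μ y)) (mmRead Lc (K2OfK … ν y′)) (diagK ((γ/(σ·Lc^{d+1}))·ctGenM … μ y)) (diagK ((γ/(σ·Lc^{d+1}))·ctGenM … ν y′)) (diagK (mmSym Lc h))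
     − mmRead Lc (K ∘ R ∘ K) + [the `mm`-reads of the four composed sandwich-defect words of `SecondOrderInverseShapeDefect.K3_sharp_defect`] )`.
* §3 **`mmRead_K3OfK_Gsym_bref_of_law`** (and the primed form `…_of_law'` with the remainder PACKAGED as `− mmRead Lc (G∘R∘G − (w₁+w₂+w₃+w₄))`, the (hQ) shape of `SecondOrderStepLawGen.quarticStep_bref_of_laws_gen`) — THE LITERAL'S INSTANCE `(K, 𝕄, σ, B) := (Gsym Lc j, bhKStepSh d Lc Dsh j, stepScale d Lc j, bhK Lc + Dsh)` under
  (Dspr)(Dnull)(Dmm)(DG), `Odd Lc`: every block fact from `RelInvFactorSandwich` §4, `refK` by `SymmetrisedDressingReflection.refK_coDressKSymAt_KInvStep`,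
  the dressed generator's summability ∕ localisation by `E3ContactGenerator` — only TABLE data stays hypothesis (the three sharp laws at level `j`, a
  localisation rate of `S`, the localisations of `dM`, `W`, `R`, `diagK h`) — and the four inner defect reads stay DISPLAYED (they are commutator-valued,
  `ChartConjugationRelativeSX.sandwichDefect_rel`; their table-level shape is the object of an3's second-order audit ∕ (N8)).
NOT HERE: the assembly with the border sector `(cB·wB2) • vh₂S` and the units locks (the level step of `T2RecOf`, (N7b)); the END (N7d).
Provenance: β sub-cell, unit beta-an2 gen 31, 2026-08-21 (v1); over `SecondOrderContactMmReadDefect` (this gen), `E3ContactFactor` ∕ `E3ContactGenerator` ∕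
`RelInvFactorSandwich` (gen 28), `SecondOrderContactMmRead` (gen 18) BY NAME; no existing file touched.
-/

noncomputable section

open Finset
open scoped BigOperators
open Literature.Probability.LatticeModels (Torus.proj)
open Literature.MathematicalPhysics.QuantumFieldTheory
open Literature.MathematicalPhysics.QuantumFieldTheory.Balaban1983to89
open Literature.MathematicalPhysics.QuantumFieldTheory.Balaban1983to89.Beta
open ExpKernelCalculus (MKer comp Decays BiLoc)
open PolarizationSign (reflSign)
open KernelReflection (refK)
open ResolventReflection (bref Φ)
open OneStepResolventKernel (Fib LocStencil)
open OneStepKernelFamily (KInvStep colH)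
open BalabanStepJetsSucc (mmRead)
open SecondOrderResponse (dM K2OfK)
open BalabanStepW2 (K3OfK)
open AveragingContoursRooted (ctr ctrOff ctrOff_mem_box)
open Summit.QuantumFields.BalabanUV.Beta.TameKernelCalculus
open Summit.QuantumFields.BalabanUV.Beta.ChartConjugation (conjV conjW)
open Summit.QuantumFields.BalabanUV.Beta.AxialDressingRooted (one_le_of_neZero)
open Summit.QuantumFields.BalabanUV.Beta.BorderedHessian (bhK spr_bhK bhKStep stepScale stepScale_ne_zero diagK)
open Summit.QuantumFields.BalabanUV.Beta.SymSliceProjectorKernel (symEc)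
open Summit.QuantumFields.BalabanUV.Beta.WardLocusCubic (mmSym)
open Summit.QuantumFields.BalabanUV.Beta.VertexReflectionContact (smul_diagK summable_colH_mul_of_locStencil)
open Summit.QuantumFields.BalabanUV.Beta.SecondOrderContactMmRead (conjW_mmRead_diag_congr mmSym_inl)
open Summit.QuantumFields.BalabanUV.Beta.ChartConjugationDefectEnd (sandwichDefect)
open Summit.QuantumFields.BalabanUV.Beta.SecondOrderContactMmReadDefect (mmRead_K3OfK_bref_sharp_split_defect)
open Summit.QuantumFields.BalabanUV.Beta.SymmetrisedStepJets (Gsym Gsym_apply)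
open Summit.QuantumFields.BalabanUV.Beta.SymShiftedSpread (bhKStepSh spr_bhKStepSh)
open Summit.QuantumFields.BalabanUV.Beta.SymmetrisedDressingReflection (refK_coDressKSymAt_KInvStep)
open Summit.QuantumFields.BalabanUV.Beta.RelInvNullShift (spr_add)
open Summit.QuantumFields.BalabanUV.Beta.RelInvFactorSandwich (spr_Gsym Gsym_inr_row_coarse Gsym_inr_col_coarse comp_bhKStepSh_Gsym_inl_inr
  comp_Gsym_bhKStepSh_inr_inl comp_bhKStepSh_Gsym_inr_inr comp_Gsym_bhKStepSh_inr_inr)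
open Summit.QuantumFields.BalabanUV.Beta.E3ContactGenerator (ctGenM summable_colH_mul_ctGenM loc_diagK_dressedGenM)
open Summit.QuantumFields.BalabanUV.Beta.E3ContactFactor (dressedGenM_zsmul_inr bhKStepSh_mf bhKStepSh_mm)
open Summit.QuantumFields.BalabanUV.Beta.VertexReflectionContact (mmRead_add)
open Summit.QuantumFields.BalabanUV.Beta.GAN24.ThirdJetKernel (mmRead_sub)

namespace Summit.QuantumFields.BalabanUV.Beta.SecondOrderStepEvalSym

variable {d : ℕ}

/-! ## §1 The coarse symbol of the scaled dressed generator, chart-free -/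

section Coarse

variable {Lc : ℕ} [NeZero Lc] {K 𝕄 B : MKer (d + 1) (Fib d)}

/-- [folklore] The `γ`-scaled dressed generator symbol is `γ ·` the dressed generator symbol (termwise `tsum_mul_left`). -/
theorem dressedGenM_smul_eq (K : MKer (d + 1) (Fib d)) (B : MKer (d + 1) (Fib d)) (N L : ℕ) (γ : ℝ) (α μ : Fin (d + 1)) (y : Fin (d + 1) → ℤ) :
    (fun p c => ∑ κ, ∑' u, colH K N μ y κ u * (γ * ctGenM d B α L κ u p c)) =
      fun p c => γ * ∑ κ, ∑' u, colH K N μ y κ u * ctGenM d B α L κ u p c := by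
  funext p c
  rw [Finset.mul_sum]
  refine Finset.sum_congr rfl fun κ _ => ?_
  rw [← tsum_mul_left]
  exact tsum_congr fun u => by ring

/-- [folklore] **THE COARSE SYMBOL OF THE SCALED `ℋ`-DRESSED GENERATOR IS THE GENERATOR ON THE FIELD LEGS, CHART-FREE** (twin of
`SecondOrderContactMmRead.mmSym_dressedGen_inl`; engine `E3ContactFactor.dressedGenM_zsmul_inr`): for spread `K`, `B`, a kernel `𝕄` with multiplier–field
block `σ·B_mf`, multiplier block `0` and `(𝕄∘K)_mm = 1_coarse`,
`mmSym Lc (Gᵞ_{μ,y}) x′ (inl m) = (γ/(σ·Lc^{d+1})) · ctGenM d B α Lc μ y x′ (inl m)`, `Gᵞ_{μ,y} p c := Σ_κ Σ'_u colH K Lc μ y κ u · (γ · ctGenM d B α Lc κ u p c)`. -/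
theorem mmSym_dressedGenM_inl (hK : Spr K) (hB : Spr B) (σ : ℝ) (hσ : σ ≠ 0)
    (h𝕄mf : ∀ (x y : Fin (d + 1) → ℤ) (κ l : Fin (d + 1)), 𝕄 x y (Sum.inr κ) (Sum.inl l) = σ * B x y (Sum.inr κ) (Sum.inl l))
    (h𝕄mm : ∀ (x y : Fin (d + 1) → ℤ) (κ l : Fin (d + 1)), 𝕄 x y (Sum.inr κ) (Sum.inr l) = 0)
    (hMKmm : ∀ (x z : Fin (d + 1) → ℤ) (m m' : Fin (d + 1)), Torus.proj Lc x = 0 → Torus.proj Lc z = 0 →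
      comp 𝕄 K x z (Sum.inr m) (Sum.inr m') = if x = z ∧ m = m' then 1 else 0)
    (γ : ℝ) (α μ : Fin (d + 1)) (y x' : Fin (d + 1) → ℤ) (m : Fin (d + 1)) :
    mmSym Lc (fun p c => ∑ κ, ∑' u, colH K Lc μ y κ u * (γ * ctGenM d B α Lc κ u p c)) x' (Sum.inl m) =
      γ / (σ * (Lc : ℝ) ^ (d + 1)) * ctGenM d B α Lc μ y x' (Sum.inl m) := by
  rw [mmSym_inl]
  have h := dressedGenM_zsmul_inr (d := d) hK hB σ hσ h𝕄mf h𝕄mm hMKmm α μ y x' m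
  have e : (fun κ => ∑' u, colH K Lc μ y κ u * (γ * ctGenM d B α Lc κ u ((Lc : ℤ) • x') (Sum.inr m))) =
      fun κ => γ * ∑' u, colH K Lc μ y κ u * ctGenM d B α Lc κ u ((Lc : ℤ) • x') (Sum.inr m) := by
    funext κ
    rw [← tsum_mul_left]
    exact tsum_congr fun u => by ring
  rw [show (∑ κ, ∑' u, colH K Lc μ y κ u * (γ * ctGenM d B α Lc κ u ((Lc : ℤ) • x') (Sum.inr m))) =
      γ * ∑ κ, ∑' u, colH K Lc μ y κ u * ctGenM d B α Lc κ u ((Lc : ℤ) • x') (Sum.inr m) by rw [e, Finset.mul_sum], h]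
  ring

end Coarse

/-! ## §2 The evaluated law, level-generic and chart-free -/

section LevelGeneric

variable {Lc : ℕ} [NeZero Lc] {K 𝕄 B : MKer (d + 1) (Fib d)}

/-- [folklore] **THE REFLECTION LAW OF THE NEXT LEVEL'S FIELD–FIELD SECOND-ORDER TABLE, EVALUATED, CHART-FREE** (see the module docstring, §2).  Only
the four block facts of the pair `(K, 𝕄)`, the border blocks of `𝕄`, the coarse multiplier legs and the reflection invariance of `K` stand in for the comb's
`RelInv K 𝕄 axEc` + commutation; the four inner sandwich-defect reads are displayed. -/
theorem mmRead_K3OfK_bref_of_lawM (hK : Spr K) {α : Fin (d + 1)} (hKr : refK (Φ (d := d) Lc α) K = K) (hM : Spr 𝕄) (hB : Spr B)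
    (σ : ℝ) (hσ : σ ≠ 0)
    (hKrow : ∀ (x z : Fin (d + 1) → ℤ) (m : Fin (d + 1)) (b : Fib d), Torus.proj Lc x ≠ 0 → K x z (Sum.inr m) b = 0)
    (hKcol : ∀ (x z : Fin (d + 1) → ℤ) (a : Fib d) (m : Fin (d + 1)), Torus.proj Lc z ≠ 0 → K x z a (Sum.inr m) = 0)
    (hMKfm : ∀ (x z : Fin (d + 1) → ℤ) (a m : Fin (d + 1)), comp 𝕄 K x z (Sum.inl a) (Sum.inr m) = 0)
    (hKMmf : ∀ (x z : Fin (d + 1) → ℤ) (m a : Fin (d + 1)), comp K 𝕄 x z (Sum.inr m) (Sum.inl a) = 0)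
    (hMKmm : ∀ (x z : Fin (d + 1) → ℤ) (m m' : Fin (d + 1)), Torus.proj Lc x = 0 → Torus.proj Lc z = 0 →
      comp 𝕄 K x z (Sum.inr m) (Sum.inr m') = if x = z ∧ m = m' then 1 else 0)
    (hKMmm : ∀ (x z : Fin (d + 1) → ℤ) (m m' : Fin (d + 1)), Torus.proj Lc x = 0 → Torus.proj Lc z = 0 →
      comp K 𝕄 x z (Sum.inr m) (Sum.inr m') = if x = z ∧ m = m' then 1 else 0)
    (h𝕄mf : ∀ (x y : Fin (d + 1) → ℤ) (κ l : Fin (d + 1)), 𝕄 x y (Sum.inr κ) (Sum.inl l) = σ * B x y (Sum.inr κ) (Sum.inl l))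
    (h𝕄mm : ∀ (x y : Fin (d + 1) → ℤ) (κ l : Fin (d + 1)), 𝕄 x y (Sum.inr κ) (Sum.inr l) = 0)
    (γ : ℝ) {S M : Fin (d + 1) → (Fin (d + 1) → ℤ) → MKer (d + 1) (Fib d)}
    {W R : Fin (d + 1) → (Fin (d + 1) → ℤ) → Fin (d + 1) → (Fin (d + 1) → ℤ) → MKer (d + 1) (Fib d)}
    {h : Fin (d + 1) → (Fin (d + 1) → ℤ) → Fin (d + 1) → (Fin (d + 1) → ℤ) → (Fin (d + 1) → ℤ) → Fib d → ℝ}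
    (hS : ∀ κ u, S κ (bref α κ u) = reflSign α κ • refK (Φ Lc α)
      (S κ u + conjV 𝕄 (diagK fun p c => γ * ctGenM d B α Lc κ u p c)))
    (hMt : ∀ ρ w, M ρ (bref α ρ w) = reflSign α ρ • refK (Φ Lc α) (M ρ w))
    (hW : ∀ μ y ν y', W μ (bref α μ y) ν (bref α ν y') = (reflSign α μ * reflSign α ν) • refK (Φ Lc α)
      (W μ y ν y' +
        conjW 𝕄 (dM K Lc S M μ y) (dM K Lc S M ν y')
          (diagK fun p c => ∑ κ, ∑' u, colH K Lc μ y κ u * (γ * ctGenM d B α Lc κ u p c))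
          (diagK fun p c => ∑ κ, ∑' u, colH K Lc ν y' κ u * (γ * ctGenM d B α Lc κ u p c))
          (diagK (h μ y ν y')) + R μ y ν y'))
    (hSl : ∃ Cs δ : ℝ, 0 < δ ∧ LocStencil S Cs δ)
    (hD : ∀ ν y', Loc (dM K Lc S M ν y')) (hWl : ∀ μ y ν y', Loc (W μ y ν y')) (hRl : ∀ μ y ν y', Loc (R μ y ν y'))
    (hhl : ∀ μ y ν y', Loc (diagK (h μ y ν y')))
    (μ : Fin (d + 1)) (y : Fin (d + 1) → ℤ) (ν : Fin (d + 1)) (y' : Fin (d + 1) → ℤ) :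
    mmRead Lc (K3OfK K Lc S M W μ (bref α μ y) ν (bref α ν y')) =
      (reflSign α μ * reflSign α ν) • refK (Φ (d := d) Lc α)
        (mmRead Lc (K3OfK K Lc S M W μ y ν y') +
          conjW (mmRead Lc K) (mmRead Lc (K2OfK K Lc S M μ y)) (mmRead Lc (K2OfK K Lc S M ν y'))
            (diagK fun p c => γ / (σ * (Lc : ℝ) ^ (d + 1)) * ctGenM d B α Lc μ y p c)
            (diagK fun p c => γ / (σ * (Lc : ℝ) ^ (d + 1)) * ctGenM d B α Lc ν y' p c) (diagK (mmSym Lc (h μ y ν y'))) -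
          mmRead Lc (comp (comp K (R μ y ν y')) K)
          + (mmRead Lc (comp (sandwichDefect K 𝕄 (diagK fun p c => ∑ κ, ∑' u, colH K Lc μ y κ u * (γ * ctGenM d B α Lc κ u p c)))
                (comp (dM K Lc S M ν y') K - diagK fun p c => ∑ κ, ∑' u, colH K Lc ν y' κ u * (γ * ctGenM d B α Lc κ u p c)))
            + mmRead Lc (comp (comp K (dM K Lc S M μ y + conjV 𝕄 (diagK fun p c => ∑ κ, ∑' u, colH K Lc μ y κ u * (γ * ctGenM d B α Lc κ u p c))))
                (sandwichDefect K 𝕄 (diagK fun p c => ∑ κ, ∑' u, colH K Lc ν y' κ u * (γ * ctGenM d B α Lc κ u p c))))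
            + mmRead Lc (comp (sandwichDefect K 𝕄 (diagK fun p c => ∑ κ, ∑' u, colH K Lc ν y' κ u * (γ * ctGenM d B α Lc κ u p c)))
                (comp (dM K Lc S M μ y) K - diagK fun p c => ∑ κ, ∑' u, colH K Lc μ y κ u * (γ * ctGenM d B α Lc κ u p c)))
            + mmRead Lc (comp (comp K (dM K Lc S M ν y' + conjV 𝕄 (diagK fun p c => ∑ κ, ∑' u, colH K Lc ν y' κ u * (γ * ctGenM d B α Lc κ u p c))))
                (sandwichDefect K 𝕄 (diagK fun p c => ∑ κ, ∑' u, colH K Lc μ y κ u * (γ * ctGenM d B α Lc κ u p c)))))) := by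
  obtain ⟨Cs, δs, hδs, hSloc⟩ := hSl
  have hKd : ∃ δ C : ℝ, 0 < δ ∧ 0 ≤ C ∧ Decays K C δ := E3GenericReflection.Spr.decays' hK
  obtain ⟨δB, CB, hδB, -, hBd⟩ := E3GenericReflection.Spr.decays' hB
  -- the dressed generator: summability and localisation
  have hg : ∀ (μ : Fin (d + 1)) (y : Fin (d + 1) → ℤ) (κ : Fin (d + 1)) (p : Fin (d + 1) → ℤ) (c : Fib d),
      Summable fun u => colH K Lc μ y κ u * (γ * ctGenM d B α Lc κ u p c) := fun μ y κ p c =>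
    ((summable_colH_mul_ctGenM (N := Lc) (L := Lc) (α := α) hKd hBd hδB.le μ y κ p c).mul_left γ).congr fun u => by ring
  have hGl : ∀ (μ : Fin (d + 1)) (y : Fin (d + 1) → ℤ),
      Loc (diagK fun p c => ∑ κ, ∑' u, colH K Lc μ y κ u * (γ * ctGenM d B α Lc κ u p c)) := fun μ y => by
    rw [dressedGenM_smul_eq, ← smul_diagK]
    exact (loc_diagK_dressedGenM α hK hB μ y).smul γ
  rw [mmRead_K3OfK_bref_sharp_split_defect (N := Lc) Lc hKr hK hM hKrow hKcol hMKfm hKMmf hMKmm hKMmm hS hMt hW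
      (fun μ y κ x z a b => summable_colH_mul_of_locStencil hKd hSloc hδs μ y κ x z a b) hg hD hWl hRl hGl hhl μ y ν y',
    conjW_mmRead_diag_congr Lc (g₁ := fun p c => γ / (σ * (Lc : ℝ) ^ (d + 1)) * ctGenM d B α Lc μ y p c)
      (g₁' := fun p c => γ / (σ * (Lc : ℝ) ^ (d + 1)) * ctGenM d B α Lc ν y' p c) (h₁ := mmSym Lc (h μ y ν y')) _ _ _
      (fun x m => mmSym_dressedGenM_inl hK hB σ hσ h𝕄mf h𝕄mm hMKmm γ α μ y x m)
      (fun x m => mmSym_dressedGenM_inl hK hB σ hσ h𝕄mf h𝕄mm hMKmm γ α ν y' x m)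
      (fun x m => rfl)]

end LevelGeneric

/-! ## §3 The literal: `Gsym j` against the shifted spread `bhKStepSh Dsh j`, border `bhK + Dsh` -/

section Literal

variable {Lc : ℕ} [NeZero Lc] {Dsh : MKer (d + 1) (Fib d)}

/-- [folklore] **THE EVALUATED SECOND-ORDER STEP LAW FOR THE (0.4) LITERAL'S RESOLVENTS AT EVERY LEVEL** (RULING R-D1-g28-2, memo N7-SCOPE (N7a)→(N7b)):
`Lc` odd; the shift `Dsh` with (Dspr) `Spr Dsh`, (Dnull) `symEc∘Dsh∘symEc = 0`, (Dmm) `Dsh_mm = 0`, (DG) `(G_j∘Dsh)_mf = 0 ∧ (Dsh∘G_j)_fm = 0`; table data: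
the first-order sharp laws of `S` (contact `γ · ctGenM d (bhK Lc + Dsh) α Lc` against `bhKStepSh d Lc Dsh j`) and `M` (pure sign), the second-order sharp law
of `W` of similarity shape up to `R`, a localisation rate of `S`, the localisations of `dM`, `W`, `R`, `diagK h`.  Then the level-`(j+1)` field–field table
`mmRead Lc (K3OfK (Gsym Lc j) Lc S M W …)` obeys the reflection law of SIMILARITY SHAPE against `mmRead Lc (Gsym Lc j)` with first-order letters
`mmRead Lc (K2OfK …)`, coarse generators `(γ/(stepScale j·Lc^{d+1})) · ctGenM d (bhK Lc + Dsh) α Lc`, second symbol `mmSym Lc h`, MINUS the transported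
remainder, PLUS the `mm`-reads of the four inner sandwich-defect words (displayed; `sandwichDefect (Gsym Lc j) (bhKStepSh d Lc Dsh j) ·`). -/
theorem mmRead_K3OfK_Gsym_bref_of_law (hLc : Odd Lc) (j : ℕ) (hDs : Spr Dsh) (hDnull : comp (comp (symEc Lc) Dsh) (symEc Lc) = 0)
    (hDmm : ∀ (x y : Fin (d + 1) → ℤ) (κ l : Fin (d + 1)), Dsh x y (Sum.inr κ) (Sum.inr l) = 0)
    (hGD : ∀ (x z : Fin (d + 1) → ℤ) (m a : Fin (d + 1)), comp (Gsym (d := d) Lc j) Dsh x z (Sum.inr m) (Sum.inl a) = 0)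
    (hDG : ∀ (x z : Fin (d + 1) → ℤ) (a m : Fin (d + 1)), comp Dsh (Gsym (d := d) Lc j) x z (Sum.inl a) (Sum.inr m) = 0)
    {α : Fin (d + 1)} (γ : ℝ) {S M : Fin (d + 1) → (Fin (d + 1) → ℤ) → MKer (d + 1) (Fib d)}
    {W R : Fin (d + 1) → (Fin (d + 1) → ℤ) → Fin (d + 1) → (Fin (d + 1) → ℤ) → MKer (d + 1) (Fib d)}
    {h : Fin (d + 1) → (Fin (d + 1) → ℤ) → Fin (d + 1) → (Fin (d + 1) → ℤ) → (Fin (d + 1) → ℤ) → Fib d → ℝ}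
    (hS : ∀ κ u, S κ (bref α κ u) = reflSign α κ • refK (Φ Lc α)
      (S κ u + conjV (bhKStepSh d Lc Dsh j) (diagK fun p c => γ * ctGenM d (bhK Lc + Dsh) α Lc κ u p c)))
    (hMt : ∀ ρ w, M ρ (bref α ρ w) = reflSign α ρ • refK (Φ Lc α) (M ρ w))
    (hW : ∀ μ y ν y', W μ (bref α μ y) ν (bref α ν y') = (reflSign α μ * reflSign α ν) • refK (Φ Lc α)
      (W μ y ν y' +
        conjW (bhKStepSh d Lc Dsh j) (dM (Gsym Lc j) Lc S M μ y) (dM (Gsym Lc j) Lc S M ν y')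
          (diagK fun p c => ∑ κ, ∑' u, colH (Gsym Lc j) Lc μ y κ u * (γ * ctGenM d (bhK Lc + Dsh) α Lc κ u p c))
          (diagK fun p c => ∑ κ, ∑' u, colH (Gsym Lc j) Lc ν y' κ u * (γ * ctGenM d (bhK Lc + Dsh) α Lc κ u p c))
          (diagK (h μ y ν y')) + R μ y ν y'))
    (hSl : ∃ Cs δ : ℝ, 0 < δ ∧ LocStencil S Cs δ)
    (hD : ∀ ν y', Loc (dM (Gsym Lc j) Lc S M ν y')) (hWl : ∀ μ y ν y', Loc (W μ y ν y')) (hRl : ∀ μ y ν y', Loc (R μ y ν y'))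
    (hhl : ∀ μ y ν y', Loc (diagK (h μ y ν y')))
    (μ : Fin (d + 1)) (y : Fin (d + 1) → ℤ) (ν : Fin (d + 1)) (y' : Fin (d + 1) → ℤ) :
    mmRead Lc (K3OfK (Gsym Lc j) Lc S M W μ (bref α μ y) ν (bref α ν y')) =
      (reflSign α μ * reflSign α ν) • refK (Φ (d := d) Lc α)
        (mmRead Lc (K3OfK (Gsym Lc j) Lc S M W μ y ν y') +
          conjW (mmRead Lc (Gsym (d := d) Lc j)) (mmRead Lc (K2OfK (Gsym Lc j) Lc S M μ y)) (mmRead Lc (K2OfK (Gsym Lc j) Lc S M ν y'))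
            (diagK fun p c => γ / (stepScale d Lc j * (Lc : ℝ) ^ (d + 1)) * ctGenM d (bhK Lc + Dsh) α Lc μ y p c)
            (diagK fun p c => γ / (stepScale d Lc j * (Lc : ℝ) ^ (d + 1)) * ctGenM d (bhK Lc + Dsh) α Lc ν y' p c)
            (diagK (mmSym Lc (h μ y ν y'))) -
          mmRead Lc (comp (comp (Gsym Lc j) (R μ y ν y')) (Gsym Lc j))
          + (mmRead Lc (comp (sandwichDefect (Gsym Lc j) (bhKStepSh d Lc Dsh j)
                  (diagK fun p c => ∑ κ, ∑' u, colH (Gsym Lc j) Lc μ y κ u * (γ * ctGenM d (bhK Lc + Dsh) α Lc κ u p c)))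
                (comp (dM (Gsym Lc j) Lc S M ν y') (Gsym Lc j) -
                  diagK fun p c => ∑ κ, ∑' u, colH (Gsym Lc j) Lc ν y' κ u * (γ * ctGenM d (bhK Lc + Dsh) α Lc κ u p c)))
            + mmRead Lc (comp (comp (Gsym Lc j) (dM (Gsym Lc j) Lc S M μ y +
                  conjV (bhKStepSh d Lc Dsh j) (diagK fun p c => ∑ κ, ∑' u, colH (Gsym Lc j) Lc μ y κ u * (γ * ctGenM d (bhK Lc + Dsh) α Lc κ u p c))))
                (sandwichDefect (Gsym Lc j) (bhKStepSh d Lc Dsh j)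
                  (diagK fun p c => ∑ κ, ∑' u, colH (Gsym Lc j) Lc ν y' κ u * (γ * ctGenM d (bhK Lc + Dsh) α Lc κ u p c))))
            + mmRead Lc (comp (sandwichDefect (Gsym Lc j) (bhKStepSh d Lc Dsh j)
                  (diagK fun p c => ∑ κ, ∑' u, colH (Gsym Lc j) Lc ν y' κ u * (γ * ctGenM d (bhK Lc + Dsh) α Lc κ u p c)))
                (comp (dM (Gsym Lc j) Lc S M μ y) (Gsym Lc j) -
                  diagK fun p c => ∑ κ, ∑' u, colH (Gsym Lc j) Lc μ y κ u * (γ * ctGenM d (bhK Lc + Dsh) α Lc κ u p c)))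
            + mmRead Lc (comp (comp (Gsym Lc j) (dM (Gsym Lc j) Lc S M ν y' +
                  conjV (bhKStepSh d Lc Dsh j) (diagK fun p c => ∑ κ, ∑' u, colH (Gsym Lc j) Lc ν y' κ u * (γ * ctGenM d (bhK Lc + Dsh) α Lc κ u p c))))
                (sandwichDefect (Gsym Lc j) (bhKStepSh d Lc Dsh j)
                  (diagK fun p c => ∑ κ, ∑' u, colH (Gsym Lc j) Lc μ y κ u * (γ * ctGenM d (bhK Lc + Dsh) α Lc κ u p c)))))) := by
  have hKr : refK (Φ (d := d) Lc α) (Gsym (d := d) Lc j) = Gsym Lc j := by rw [Gsym_apply]; exact refK_coDressKSymAt_KInvStep hLc j α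
  have hB : Spr (bhK (d := d) Lc + Dsh) := spr_add (spr_bhK (one_le_of_neZero Lc)) hDs
  exact mmRead_K3OfK_bref_of_lawM (spr_Gsym j) hKr (spr_bhKStepSh hDs j) hB (stepScale d Lc j) (stepScale_ne_zero j)
    (fun x z m b hx => Gsym_inr_row_coarse j x z m b hx) (fun x z a m hz => Gsym_inr_col_coarse j x z a m hz)
    (comp_bhKStepSh_Gsym_inl_inr hDs j hDG) (comp_Gsym_bhKStepSh_inr_inl hDs j hGD)
    (fun x z m m' hx _ => comp_bhKStepSh_Gsym_inr_inr hDs hDnull j x z m m' hx)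
    (fun x z m m' _ hz => comp_Gsym_bhKStepSh_inr_inr hDs hDnull j x z m m' hz) (bhKStepSh_mf j) (bhKStepSh_mm hDmm j)
    γ hS hMt hW hSl hD hWl hRl hhl μ y ν y'

/-- [folklore] **THE SAME WITH THE REMAINDER PACKAGED** — the transported remainder and the four inner defect words in ONE kernel
`R₀ := G_j∘R∘G_j − (w₁ + w₂ + w₃ + w₄)`, read through `mmRead Lc` with a minus sign: the shape `… − mmRead N (R₀ κ u κ′ u′)` consumed by the assembly
`SecondOrderStepLawGen.quarticStep_bref_of_laws_gen` (hQ) — so that the literal's level step is a one-line instantiation. -/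
theorem mmRead_K3OfK_Gsym_bref_of_law' (hLc : Odd Lc) (j : ℕ) (hDs : Spr Dsh) (hDnull : comp (comp (symEc Lc) Dsh) (symEc Lc) = 0)
    (hDmm : ∀ (x y : Fin (d + 1) → ℤ) (κ l : Fin (d + 1)), Dsh x y (Sum.inr κ) (Sum.inr l) = 0)
    (hGD : ∀ (x z : Fin (d + 1) → ℤ) (m a : Fin (d + 1)), comp (Gsym (d := d) Lc j) Dsh x z (Sum.inr m) (Sum.inl a) = 0)
    (hDG : ∀ (x z : Fin (d + 1) → ℤ) (a m : Fin (d + 1)), comp Dsh (Gsym (d := d) Lc j) x z (Sum.inl a) (Sum.inr m) = 0)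
    {α : Fin (d + 1)} (γ : ℝ) {S M : Fin (d + 1) → (Fin (d + 1) → ℤ) → MKer (d + 1) (Fib d)}
    {W R : Fin (d + 1) → (Fin (d + 1) → ℤ) → Fin (d + 1) → (Fin (d + 1) → ℤ) → MKer (d + 1) (Fib d)}
    {h : Fin (d + 1) → (Fin (d + 1) → ℤ) → Fin (d + 1) → (Fin (d + 1) → ℤ) → (Fin (d + 1) → ℤ) → Fib d → ℝ}
    (hS : ∀ κ u, S κ (bref α κ u) = reflSign α κ • refK (Φ Lc α)
      (S κ u + conjV (bhKStepSh d Lc Dsh j) (diagK fun p c => γ * ctGenM d (bhK Lc + Dsh) α Lc κ u p c)))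
    (hMt : ∀ ρ w, M ρ (bref α ρ w) = reflSign α ρ • refK (Φ Lc α) (M ρ w))
    (hW : ∀ μ y ν y', W μ (bref α μ y) ν (bref α ν y') = (reflSign α μ * reflSign α ν) • refK (Φ Lc α)
      (W μ y ν y' +
        conjW (bhKStepSh d Lc Dsh j) (dM (Gsym Lc j) Lc S M μ y) (dM (Gsym Lc j) Lc S M ν y')
          (diagK fun p c => ∑ κ, ∑' u, colH (Gsym Lc j) Lc μ y κ u * (γ * ctGenM d (bhK Lc + Dsh) α Lc κ u p c))
          (diagK fun p c => ∑ κ, ∑' u, colH (Gsym Lc j) Lc ν y' κ u * (γ * ctGenM d (bhK Lc + Dsh) α Lc κ u p c))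
          (diagK (h μ y ν y')) + R μ y ν y'))
    (hSl : ∃ Cs δ : ℝ, 0 < δ ∧ LocStencil S Cs δ)
    (hD : ∀ ν y', Loc (dM (Gsym Lc j) Lc S M ν y')) (hWl : ∀ μ y ν y', Loc (W μ y ν y')) (hRl : ∀ μ y ν y', Loc (R μ y ν y'))
    (hhl : ∀ μ y ν y', Loc (diagK (h μ y ν y')))
    (μ : Fin (d + 1)) (y : Fin (d + 1) → ℤ) (ν : Fin (d + 1)) (y' : Fin (d + 1) → ℤ) :
    mmRead Lc (K3OfK (Gsym Lc j) Lc S M W μ (bref α μ y) ν (bref α ν y')) =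
      (reflSign α μ * reflSign α ν) • refK (Φ (d := d) Lc α)
        (mmRead Lc (K3OfK (Gsym Lc j) Lc S M W μ y ν y') +
          conjW (mmRead Lc (Gsym (d := d) Lc j)) (mmRead Lc (K2OfK (Gsym Lc j) Lc S M μ y)) (mmRead Lc (K2OfK (Gsym Lc j) Lc S M ν y'))
            (diagK fun p c => γ / (stepScale d Lc j * (Lc : ℝ) ^ (d + 1)) * ctGenM d (bhK Lc + Dsh) α Lc μ y p c)
            (diagK fun p c => γ / (stepScale d Lc j * (Lc : ℝ) ^ (d + 1)) * ctGenM d (bhK Lc + Dsh) α Lc ν y' p c)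
            (diagK (mmSym Lc (h μ y ν y'))) -
          mmRead Lc (comp (comp (Gsym Lc j) (R μ y ν y')) (Gsym Lc j) -
            (comp (sandwichDefect (Gsym Lc j) (bhKStepSh d Lc Dsh j)
                  (diagK fun p c => ∑ κ, ∑' u, colH (Gsym Lc j) Lc μ y κ u * (γ * ctGenM d (bhK Lc + Dsh) α Lc κ u p c)))
                (comp (dM (Gsym Lc j) Lc S M ν y') (Gsym Lc j) -
                  diagK fun p c => ∑ κ, ∑' u, colH (Gsym Lc j) Lc ν y' κ u * (γ * ctGenM d (bhK Lc + Dsh) α Lc κ u p c))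
              + comp (comp (Gsym Lc j) (dM (Gsym Lc j) Lc S M μ y +
                  conjV (bhKStepSh d Lc Dsh j) (diagK fun p c => ∑ κ, ∑' u, colH (Gsym Lc j) Lc μ y κ u * (γ * ctGenM d (bhK Lc + Dsh) α Lc κ u p c))))
                (sandwichDefect (Gsym Lc j) (bhKStepSh d Lc Dsh j)
                  (diagK fun p c => ∑ κ, ∑' u, colH (Gsym Lc j) Lc ν y' κ u * (γ * ctGenM d (bhK Lc + Dsh) α Lc κ u p c)))
              + comp (sandwichDefect (Gsym Lc j) (bhKStepSh d Lc Dsh j)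
                  (diagK fun p c => ∑ κ, ∑' u, colH (Gsym Lc j) Lc ν y' κ u * (γ * ctGenM d (bhK Lc + Dsh) α Lc κ u p c)))
                (comp (dM (Gsym Lc j) Lc S M μ y) (Gsym Lc j) -
                  diagK fun p c => ∑ κ, ∑' u, colH (Gsym Lc j) Lc μ y κ u * (γ * ctGenM d (bhK Lc + Dsh) α Lc κ u p c))
              + comp (comp (Gsym Lc j) (dM (Gsym Lc j) Lc S M ν y' +
                  conjV (bhKStepSh d Lc Dsh j) (diagK fun p c => ∑ κ, ∑' u, colH (Gsym Lc j) Lc ν y' κ u * (γ * ctGenM d (bhK Lc + Dsh) α Lc κ u p c))))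
                (sandwichDefect (Gsym Lc j) (bhKStepSh d Lc Dsh j)
                  (diagK fun p c => ∑ κ, ∑' u, colH (Gsym Lc j) Lc μ y κ u * (γ * ctGenM d (bhK Lc + Dsh) α Lc κ u p c)))))) := by
  rw [mmRead_K3OfK_Gsym_bref_of_law hLc j hDs hDnull hDmm hGD hDG γ hS hMt hW hSl hD hWl hRl hhl μ y ν y', mmRead_sub, mmRead_add, mmRead_add,
    mmRead_add]
  congr 2
  abel

end Literal

end Summit.QuantumFields.BalabanUV.Beta.SecondOrderStepEvalSym

end
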